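import Summits.Ventures.HSemireg.EmbeddedFirstOrderDeformationsCechMinusNClasses
import Summits.Ventures.HSemireg.EmbeddedFirstOrderDeformationsCechMinusOneCurve

/-!
# Venture HSemireg — on `𝒪_{ℙ¹}(−n)` the twists `s^{−j}∂/∂p` with `j ≥ n` do NOT obstruct: the zero section lifts
# (complement of `…CechMinusNClasses`: together, along `s^{−j}∂/∂p`, `j ≥ 1`, the zero section lifts ⟺ `j ≥ n`)

HONEST FRAMING.  Lean side of the computation cell `pub-hsemireg` (track «S4-PUSH» (ii), seat s4-prove-3 g6, second
route for (S5)); log `s4push/prove-3/ATTEMPT-10.md` §5o.  Same atlas as `…CechMinusNCurve` (`q = s^{m+1}p`, `n = m+1`),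
twist `θ^{(j)} = s^{−j}∂/∂p` with `j = m + 1 + d ≥ n`: the class `s^{−j} ∈ s^{−n}·k[s^{−1}]` IS a coboundary
(`φ₀ = 0`, `φ₁ = (q ↦ t^d)`), so the zero section LIFTS.  With `…CechMinusNClasses` (`1 ≤ j ≤ n − 1`: no lift) this
is the exact image statement: `Ȟ¹ = k[s,s⁻¹]/(k[s] + s^{−n}k[s⁻¹])` has basis `s^{−1}, …, s^{−(n−1)}`.  Plain
commutative algebra; no Mathlib scheme, sheaf, abelian variety or semiregularity map; nothing here says that HC, HC_CM or
HC_AV holds; no object is certified; no Literature fact is declared.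

WHAT (namespace `Summit.Ventures.HSemireg.EmbeddedDeformation.DoubledLine`; parameters `m d : ℕ`): `powNormal d`
(`= s^d · unitNormal`, the normal field `q ↦ t^d` in `k[s,p]`-coordinates), `res_powNormal_apply`,
**`exists_isAtlasLift_minusN_pow_of_le`** (`j = m + 1 + d`: the zero section of `𝒪_{ℙ¹}(−m−1)` lifts along
`s^{−j}∂/∂p`).

References: R. Hartshorne, *Deformation Theory*, GTM 257 (2010), §6 Thm. 6.2 (b) [corpus:
book:springernd-deformation-theory p0054].
-/

namespace Summit.Ventures.HSemireg

namespace EmbeddedDeformation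

namespace DoubledLine

open DualNumber TrivSqZeroExt MvPolynomial

universe u

variable (k : Type u) [CommRing k] (m d : ℕ)

/-- The normal field `q ↦ t^d` of chart 1 in `k[s,p]`-coordinates: `s^d · unitNormal`. -/
noncomputable def powNormal : idealZ k 1 →ₗ[A k] A k ⧸ idealZ k 1 := (X 0 ^ d : A k) • unitNormal k 1

/-- `powNormal d (p) = s^d mod p`. [folklore] -/
theorem powNormal_apply_X_one (h : (X 1 : A k) ∈ idealZ k 1) :
    powNormal k d ⟨X 1, h⟩ = Ideal.Quotient.mk _ (X 0 ^ d) := by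
  rw [powNormal, LinearMap.smul_apply, unitNormal_apply_X_one]
  change Ideal.Quotient.mk (idealZ k 1) (X 0 ^ d * 1) = _
  rw [mul_one]

/-- `(s⁻¹)^i · (s/1)^i = 1`. [folklore] -/
theorem invSelf_pow_mul_algebraMap_pow (i : ℕ) :
    IsLocalization.Away.invSelf (S := L k) (X 0 : A k) ^ i * algebraMap (A k) (L k) (X 0) ^ i = 1 := by
  rw [← mul_pow, mul_comm, IsLocalization.Away.mul_invSelf, one_pow]

/-- The restriction of `powNormal d` along the second chart map of `𝒪_{ℙ¹}(−m−1)` at the generator `p/1` is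
`(s⁻¹)^{m+1+d}` (its value at `s^{m+1}p` is `(s⁻¹)^d`). [folklore] -/
theorem res_powNormal_apply {γ δ : Fin 2} {ρ : (A k)[ε] →+* (L k)[ε]}
    (hρ : IsThickeningHom (fstRingHom (A k)) (ε : (A k)[ε]) (fstRingHom (L k)) (ε : (L k)[ε]) ρ (resMN k m 1))
    (hP : PreservesLifts (fstRingHom (A k)) (ε : (A k)[ε]) (fstRingHom (L k)) (ε : (L k)[ε]) ρ (idealZ k 1)
      (idealZ₂ k γ δ))
    {K₀ : Ideal (A k)[ε]} (h₀ : IsLift (fstRingHom (A k)) (ε : (A k)[ε]) (idealZ k 1) K₀)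
    (hmem : algebraMap (A k) (L k) (X 1) ∈ idealZ₂ k γ δ) :
    resNormal (isFirstOrderThickening_dualNumber (A k)) (isFirstOrderThickening_dualNumber (L k)) hP h₀
        (powNormal k d) ⟨algebraMap (A k) (L k) (X 1), hmem⟩ =
      Ideal.Quotient.mk (idealZ₂ k γ δ) (IsLocalization.Away.invSelf (X 0 : A k) ^ (m + 1 + d)) := by
  have hX1 : (X 1 : A k) ∈ idealZ k 1 := Ideal.subset_span rfl
  have hmem₁ : resMN k m 1 (X 1) ∈ idealZ₂ k γ δ := by
    rw [resMN_one_X_one]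
    exact Ideal.mul_mem_left _ _ hmem
  have e1 := resNormal_apply (hT := isFirstOrderThickening_dualNumber (A k))
    (hT' := isFirstOrderThickening_dualNumber (L k)) hρ hP h₀ (powNormal k d) ⟨X 1, hX1⟩ (X 0 ^ d)
    (powNormal_apply_X_one k d hX1).symm hmem₁
  have hx : (⟨resMN k m 1 (X 1), hmem₁⟩ : idealZ₂ k γ δ) =
      algebraMap (A k) (L k) (X 0) ^ (m + 1) • (⟨algebraMap (A k) (L k) (X 1), hmem⟩ : idealZ₂ k γ δ) :=
    Subtype.ext (by
      show resMN k m 1 (X 1) = algebraMap (A k) (L k) (X 0) ^ (m + 1) • algebraMap (A k) (L k) (X 1)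
      rw [resMN_one_X_one, smul_eq_mul])
  rw [hx, map_smul, map_pow, resMN_one, RingHom.comp_apply] at e1
  change _ = Ideal.Quotient.mk _ (psiNHom k m (algebraMap (A k) (L k) (X 0)) ^ d) at e1
  rw [psiNHom_algebraMap, psiN₀_X_zero] at e1
  have hsm : ∀ c a : L k, c • Ideal.Quotient.mk (idealZ₂ k γ δ) a = Ideal.Quotient.mk (idealZ₂ k γ δ) (c * a) :=
    fun _ _ ↦ rfl
  -- cancel `s^{m+1}`: multiply by `(s⁻¹)^{m+1}`
  have key := congrArg (fun v ↦ IsLocalization.Away.invSelf (S := L k) (X 0 : A k) ^ (m + 1) • v) e1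
  rw [← mul_smul, invSelf_pow_mul_algebraMap_pow, one_smul] at key
  rw [key, hsm, ← pow_add]

/-- **ALONG `s^{−j}∂/∂p` WITH `j ≥ n` THE ZERO SECTION OF `𝒪_{ℙ¹}(−n)` LIFTS** (`n = m + 1`, `j = m + 1 + d`): the class
`s^{−j}` is the coboundary of `φ₀ = 0`, `φ₁ = (q ↦ t^d)` — `φ₁|(p) = s^{−(m+1)}·φ₁|(s^{m+1}p) = s^{−(m+1)}·s^{−d}`.
[cite: Hartshorne2010, §6 Thm. 6.2 (b)] -/
theorem exists_isAtlasLift_minusN_pow_of_le :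
    ∃ K : Fin 2 → Ideal (A k)[ε],
      IsAtlasLift (fun _ : Fin 2 ↦ fstRingHom (A k)) (fun _ ↦ (ε : (A k)[ε])) (fun α _ ↦ mapRingHom (resMN k m α))
        (fun α β ↦ (twist (thetaPow k (m + 1 + d) α β) : (L k)[ε] →+* (L k)[ε]).comp (mapRingHom (resMN k m β)))
        (idealZ k) K := by
  have 𝔄 := thickenedAtlas_twisted (fun α _ ↦ resMN k m α) (fun _ β ↦ resMN k m β) (idealZ k) (idealZ₂ k)
    (thetaPow k (m + 1 + d)) (preservesLifts_resMN k m) (fun α β ↦ preservesLifts_resMN k m β α)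
  have hsec := isLift_map_chartSection 𝔄 (fun _ ↦ algebraMap (A k) (A k)[ε]) fun _ ↦ fstRingHom_algebraMap
  refine (exists_isAtlasLift_twisted_iff (fun α _ ↦ resMN k m α) (fun _ β ↦ resMN k m β) (idealZ k) (idealZ₂ k)
    (thetaPow k (m + 1 + d)) (preservesLifts_resMN k m) (fun α β ↦ preservesLifts_resMN k m β α)).2
    ⟨![0, powNormal k d], fun α β ↦ ?_⟩
  have hmem : algebraMap (A k) (L k) (X 1) ∈ idealZ₂ k α β := Ideal.mem_map_of_mem _ (Ideal.subset_span rfl)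
  refine ext_of_span_X_one k hmem ?_
  rw [derivToNormal_apply, LinearMap.sub_apply]
  fin_cases α <;> fin_cases β
  · show Ideal.Quotient.mk _ (thetaPow k (m + 1 + d) 0 0 _) = resR 𝔄 hsec 0 0 0 _ - resL 𝔄 hsec 0 0 0 _
    rw [resR, resL, resNormal_zero (𝔄.homr 0 0) (𝔄.liftsr 0 0) (hsec 0), resNormal_zero (𝔄.homl 0 0) (𝔄.liftsl 0 0)
      (hsec 0), thetaPow]
    simp
  · show Ideal.Quotient.mk _ (thetaPow k (m + 1 + d) 0 1 _) = resR 𝔄 hsec 0 1 (powNormal k d) _ - resL 𝔄 hsec 0 1 0 _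
    rw [resR, resL, resNormal_zero (𝔄.homl 0 1) (𝔄.liftsl 0 1) (hsec 0), LinearMap.zero_apply, sub_zero,
      res_powNormal_apply k m d (𝔄.homr 0 1) (𝔄.liftsr 0 1) (hsec 1) hmem, thetaPow_zero_one, theta_algebraMap_X_one]
  · show Ideal.Quotient.mk _ (thetaPow k (m + 1 + d) 1 0 _) = resR 𝔄 hsec 1 0 0 _ - resL 𝔄 hsec 1 0 (powNormal k d) _
    rw [resR, resL, resNormal_zero (𝔄.homr 1 0) (𝔄.liftsr 1 0) (hsec 0), LinearMap.zero_apply, zero_sub,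
      res_powNormal_apply k m d (𝔄.homl 1 0) (𝔄.liftsl 1 0) (hsec 1) hmem, ← map_neg, thetaPow]
    simp [theta_algebraMap_X_one]
  · show Ideal.Quotient.mk _ (thetaPow k (m + 1 + d) 1 1 _) =
      resR 𝔄 hsec 1 1 (powNormal k d) _ - resL 𝔄 hsec 1 1 (powNormal k d) _
    rw [resR, resL, res_powNormal_apply k m d (𝔄.homr 1 1) (𝔄.liftsr 1 1) (hsec 1) hmem,
      res_powNormal_apply k m d (𝔄.homl 1 1) (𝔄.liftsl 1 1) (hsec 1) hmem, sub_self, thetaPow]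
    simp

end DoubledLine

end EmbeddedDeformation

end Summit.Ventures.HSemireg
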